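import Summits.CriticalPhenomena.PercolationContinuityZ3.Theorems.PercNearOneGluingNoHeavyPcintKernSymZ5B5Defs
import HarnessLib

/-!
# PCINT lane, kernel check 1/1 of the B3r window certificate `d = 5`, memory 5 (4-step windows, 10000 codes): codes `0 ≤ c < 10000`

Cell `prim-pcint`, seat `prim-pcint-2` (gen 2).  Collatz–Wielandt rows `10^5 · row ≤ 99999 · DEN · v` for the window codes in
`[0, 10000)`, by `decide +kernel` in chunks of `4000` codes (natural-number arithmetic only; `maxHeartbeats 0`).
Does NOT build on p205010.
-/

namespace Summit.CriticalPhenomena.PercolationContinuityZ3.Theorems.Pcint.Z5B5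

set_option maxHeartbeats 0 in
/-- Rows `0 ≤ c < 4000` of the certificate hold (normal forms only; binary-split scan). [folklore] -/
theorem chk_0_4000 : chk 0 4000 = true :=
  WinK.allRange_of_allRangeB (fuel := 20) (lo := 0) (len := 4000) (by decide +kernel)

set_option maxHeartbeats 0 in
/-- Rows `4000 ≤ c < 8000` of the certificate hold (normal forms only; binary-split scan). [folklore] -/
theorem chk_4000_8000 : chk 4000 8000 = true :=
  WinK.allRange_of_allRangeB (fuel := 20) (lo := 4000) (len := 4000) (by decide +kernel)

set_option maxHeartbeats 0 in
/-- Rows `8000 ≤ c < 10000` of the certificate hold (normal forms only; binary-split scan). [folklore] -/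
theorem chk_8000_10000 : chk 8000 10000 = true :=
  WinK.allRange_of_allRangeB (fuel := 20) (lo := 8000) (len := 2000) (by decide +kernel)

/-- Rows `0 ≤ c < 10000` of the certificate hold. [folklore] -/
theorem chkFile_1 : chk 0 10000 = true :=
  chk_split (chk_split chk_0_4000 chk_4000_8000) chk_8000_10000

end Summit.CriticalPhenomena.PercolationContinuityZ3.Theorems.Pcint.Z5B5
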